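import Mathlib.Algebra.CharP.Lemmas
import Mathlib.FieldTheory.Finite.Basic
import Mathlib.GroupTheory.OrderOfElement
import Literature.NumberTheory.EllipticCurves.GaloisActionProofs
import Literature.NumberTheory.EllipticCurves.ZpExtension
import HarnessLib

/-!
# Irreducibility of `E[p]` survives restriction to the layers of a `ℤ_p`-extension (`p` odd; proved)

`Proofs`-style file (theorems only: no definition, no named fact, no `sorry`) in topic
`NumberTheory/EllipticCurves`, written by the literature seat `bsd-potss-conjA-anchor` g20 (cell `bsd-potss`;
serves the asides stmt-BirchSwinnertonDyer-19386 / 19413; closes nothing; (A) / BSD is proved for no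
particular curve here).  Namespace `Literature.NumberTheory.EllipticCurves.ModPIrreducibleLayer`.

THE THEOREM (`irreducible_layerSubgroup_of_odd`).  `K` a number field, `E = W/K` elliptic, `p` an ODD prime,
`κ` any `ℤ_p`-extension of `K` with layers `K_n = K̄^{κ⁻¹(pⁿℤ_p)}`.  If `E[p]` is an irreducible `Γ_K`-module
(`W.HasIrreducibleModPGaloisRep p`: the only `Γ_K`-stable subgroups of `E[p]` are `⊥` and `⊤`), then for every
`n` the only `Gal(K̄/K_n)`-stable subgroups of `E[p]` are `⊥` and `⊤`.  NO image hypothesis: the tree's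
`FineSelmerStabilizerDescent.irreducible_layerSubgroup_of_not_dvd_card_aut_divisionField` (seat g19) needs
TAMENESS `p ∤ #Gal(K(E[p])/K)`; here the `GL₂(𝔽_p)`-image curves (e.g. the surjective-mod-`3` rows of the
cell's item 19386) are covered too.

Proof (§2, abstract: a group `Γ` acting on an elementary abelian group `V` of order `p²`, `Λ ⊴ Γ` with
`Γ = ⋃_k Λ γ₀^k` and `γ₀^{pⁿ} ∈ Λ`).  Let `U` be `Λ`-stable of order `p`, `U = ⟨u⟩`.  (1) `γ₀ u ∉ ⟨u⟩`
(else `⟨u⟩` is `Γ`-stable).  (2) `γ₀² u ∉ ⟨u⟩`: else `⟨u⟩` is stable under `γ₀^{-2}` (finiteness) and under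
`γ₀^{pⁿ} ∈ Λ`, hence under `γ₀ = γ₀^{pⁿ} (γ₀^{-2})^{(pⁿ-1)/2}` — this is where `p` ODD enters.  (3) So
`u, γ₀u, γ₀²u` span three distinct lines, each a common eigenline of `Λ` (`Λ` is normal), and an additive
endomorphism of `V ≅ (ℤ/p)²` with three distinct eigenlines is a scalar (§1): every `λ ∈ Λ` acts on `V` as an
integer scalar.  (4) In `End(V)` (where `p = 0`), `T = γ₀` satisfies `T^{pⁿ} = c` (the scalar of
`γ₀^{pⁿ} ∈ Λ`), so `(T - c)^{pⁿ} = T^{pⁿ} - c^{pⁿ} = c - c = 0` (Fermat); `T - c` is not injective on `V ≠ 0`,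
giving `v ≠ 0` with `γ₀ v = c v`; the line `⟨v⟩` is then `Λ`- and `γ₀`-stable, i.e. `Γ`-stable — contradiction.
This is the elementary case of Clifford's theorem for a normal subgroup of `p`-power index acting on a
`2`-dimensional `𝔽_p`-representation, `p` odd.

References: [Serre1972] J.-P. Serre, *Propriétés galoisiennes des points d'ordre fini des courbes elliptiques*,
Invent. Math. 15 (1972), §2 (subgroups of `GL₂(𝔽_p)`); [Washington1997] L. Washington, *Introduction to Cyclotomic
Fields*, GTM 83, §13.1 (layers of a `ℤ_p`-extension); C. Curtis, I. Reiner, *Representation theory of finite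
groups and associative algebras* (1962), §49 (Clifford's theorem) — for orientation only; the argument below is
self-contained and elementary.
-/

set_option autoImplicit false

namespace Literature.NumberTheory.EllipticCurves.ModPIrreducibleLayer

/-! ## §1 Elementary abelian groups of order `p²`: lines, and endomorphisms with three eigenlines -/

section Lines

variable {V : Type*} [AddCommGroup V] {p : ℕ} [Fact p.Prime]

/-- In a `p`-torsion abelian group a non-zero element generates a subgroup of order `p`. [folklore] -/
private theorem natCard_zmultiples_eq (hpV : ∀ v : V, p • v = 0) {w : V} (hw : w ≠ 0) :
    Nat.card (AddSubgroup.zmultiples w) = p := by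
  rw [Nat.card_zmultiples]
  exact addOrderOf_eq_prime (hpV w) hw

/-- In a `p`-torsion abelian group: if `m • w = 0` with `w ≠ 0`, then `p ∣ m`. [folklore] -/
private theorem natCast_dvd_of_zsmul_eq_zero (hpV : ∀ v : V, p • v = 0) {w : V} (hw : w ≠ 0) {m : ℤ}
    (hm : m • w = 0) : (p : ℤ) ∣ m := by
  rw [← addOrderOf_eq_prime (hpV w) hw]
  exact (addOrderOf_dvd_iff_zsmul_eq_zero).mpr hm

omit [Fact p.Prime] in
/-- `(m - n) • a = m • a - n • a` (the tree's `sub_zsmul` ends in `+ -`). [folklore] -/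
private theorem sub_zsmul' (m n : ℤ) (a : V) : (m - n) • a = m • a - n • a := by
  rw [sub_zsmul, sub_eq_add_neg]

omit [Fact p.Prime] in
/-- In a `p`-torsion abelian group an integer divisible by `p` kills everything. [folklore] -/
private theorem zsmul_eq_zero_of_natCast_dvd (hpV : ∀ v : V, p • v = 0) {m : ℤ} (hm : (p : ℤ) ∣ m) (w : V) :
    m • w = 0 := by
  obtain ⟨k, rfl⟩ := hm
  rw [mul_comm, mul_zsmul, natCast_zsmul, hpV, zsmul_zero]

/-- Two distinct lines meet trivially: if `u₁ ∉ ⟨u₀⟩` then `⟨u₀⟩ ∩ ⟨u₁⟩ = 0` (`p`-torsion group). [folklore] -/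
private theorem zmultiples_inf_zmultiples_eq_bot (hpV : ∀ v : V, p • v = 0) {u₀ u₁ : V}
    (h₁₀ : u₁ ∉ AddSubgroup.zmultiples u₀) :
    AddSubgroup.zmultiples u₀ ⊓ AddSubgroup.zmultiples u₁ = ⊥ := by
  have hp : p.Prime := Fact.out
  have hu₁ : u₁ ≠ 0 := by
    rintro rfl
    exact h₁₀ (zero_mem _)
  have hcard₁ : Nat.card (AddSubgroup.zmultiples u₁) = p := natCard_zmultiples_eq hpV hu₁
  haveI : Finite (AddSubgroup.zmultiples u₁) := Nat.finite_of_card_ne_zero (by rw [hcard₁]; exact hp.ne_zero)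
  set M := AddSubgroup.zmultiples u₀ ⊓ AddSubgroup.zmultiples u₁ with hM
  have hle : M ≤ AddSubgroup.zmultiples u₁ := inf_le_right
  have hdvd : Nat.card M ∣ p := hcard₁ ▸ AddSubgroup.card_dvd_of_le hle
  rcases (Nat.dvd_prime hp).mp hdvd with h1 | hP
  · exact AddSubgroup.eq_bot_of_card_eq M h1
  · exfalso
    have hMeq : M = AddSubgroup.zmultiples u₁ :=
      AddSubgroup.eq_of_le_of_card_ge hle (by rw [hP, hcard₁])
    have : AddSubgroup.zmultiples u₁ ≤ AddSubgroup.zmultiples u₀ := hMeq ▸ (inf_le_left : M ≤ _)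
    exact h₁₀ (this (AddSubgroup.mem_zmultiples u₁))

/-- Two distinct lines span a `p`-torsion group of order `p²`: if `u₀ ≠ 0` and `u₁ ∉ ⟨u₀⟩` then every
element is `a • u₀ + b • u₁`. [folklore] -/
private theorem exists_eq_zsmul_add_zsmul [Finite V] (hpV : ∀ v : V, p • v = 0) (hcard : Nat.card V = p ^ 2)
    {u₀ u₁ : V} (hu₀ : u₀ ≠ 0) (h₁₀ : u₁ ∉ AddSubgroup.zmultiples u₀) (v : V) :
    ∃ a b : ℤ, v = a • u₀ + b • u₁ := by
  have hp : p.Prime := Fact.out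
  set S := AddSubgroup.zmultiples u₀ ⊔ AddSubgroup.zmultiples u₁ with hS
  have hcard₀ : Nat.card (AddSubgroup.zmultiples u₀) = p := natCard_zmultiples_eq hpV hu₀
  have hdvdS : Nat.card S ∣ p ^ 2 := hcard ▸ AddSubgroup.card_addSubgroup_dvd_card S
  have hpS : p ∣ Nat.card S := hcard₀ ▸ AddSubgroup.card_dvd_of_le (le_sup_left : _ ≤ S)
  obtain ⟨k, hk2, hk⟩ := (Nat.dvd_prime_pow hp).mp hdvdS
  have hk0 : k ≠ 0 := by
    rintro rfl
    rw [hk, pow_zero, Nat.dvd_one] at hpS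
    exact hp.one_lt.ne' hpS
  have hk1 : k ≠ 1 := by
    rintro rfl
    rw [pow_one] at hk
    have hSeq : AddSubgroup.zmultiples u₀ = S :=
      AddSubgroup.eq_of_le_of_card_ge (le_sup_left : _ ≤ S) (by rw [hk, hcard₀])
    exact h₁₀ (hSeq ▸ (le_sup_right : AddSubgroup.zmultiples u₁ ≤ S) (AddSubgroup.mem_zmultiples u₁))
  have hk' : k = 2 := by omega
  have hStop : S = ⊤ := AddSubgroup.eq_top_of_card_eq S (by rw [hk, hk', hcard])
  have hv : v ∈ S := hStop ▸ AddSubgroup.mem_top v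
  obtain ⟨y, hy, z, hz, hyz⟩ := AddSubgroup.mem_sup.mp hv
  obtain ⟨a, rfl⟩ := AddSubgroup.mem_zmultiples_iff.mp hy
  obtain ⟨b, rfl⟩ := AddSubgroup.mem_zmultiples_iff.mp hz
  exact ⟨a, b, hyz.symm⟩

/-- **An additive endomorphism of an elementary abelian group of order `p²` with three distinct eigenlines is a
scalar.**  If `u₀ ≠ 0`, `u₁ ∉ ⟨u₀⟩`, `u₂ ∉ ⟨u₀⟩ ∪ ⟨u₁⟩` and `f` maps each `u_i` into `⟨u_i⟩`, then
`f = c • id` for an integer `c`.  (Write `u₂ = x u₀ + y u₁` with `x u₀ ≠ 0 ≠ y u₁`; comparing `f u₂ = c u₂` with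
`x f u₀ + y f u₁` on the decomposition `V = ⟨u₀⟩ ⊕ ⟨u₁⟩` forces the eigenvalues of `u₀`, `u₁` to be `c` mod `p`.)
[folklore] -/
private theorem exists_forall_eq_zsmul_of_three_eigenlines [Finite V] (hpV : ∀ v : V, p • v = 0)
    (hcard : Nat.card V = p ^ 2) (f : V →+ V) {u₀ u₁ u₂ : V} (hu₀ : u₀ ≠ 0)
    (h₁₀ : u₁ ∉ AddSubgroup.zmultiples u₀) (h₂₀ : u₂ ∉ AddSubgroup.zmultiples u₀)
    (h₂₁ : u₂ ∉ AddSubgroup.zmultiples u₁) (hf₀ : f u₀ ∈ AddSubgroup.zmultiples u₀)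
    (hf₁ : f u₁ ∈ AddSubgroup.zmultiples u₁) (hf₂ : f u₂ ∈ AddSubgroup.zmultiples u₂) :
    ∃ c : ℤ, ∀ v : V, f v = c • v := by
  obtain ⟨a, ha⟩ := AddSubgroup.mem_zmultiples_iff.mp hf₀
  obtain ⟨b, hb⟩ := AddSubgroup.mem_zmultiples_iff.mp hf₁
  obtain ⟨c, hc⟩ := AddSubgroup.mem_zmultiples_iff.mp hf₂
  obtain ⟨x, y, hxy⟩ := exists_eq_zsmul_add_zsmul hpV hcard hu₀ h₁₀ u₂
  refine ⟨c, fun v => ?_⟩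
  -- `x • u₀ ≠ 0` and `y • u₁ ≠ 0`
  have hx : x • u₀ ≠ 0 := by
    intro h0
    apply h₂₁
    rw [hxy, h0, zero_add]
    exact AddSubgroup.zsmul_mem _ (AddSubgroup.mem_zmultiples u₁) y
  have hy : y • u₁ ≠ 0 := by
    intro h0
    apply h₂₀
    rw [hxy, h0, add_zero]
    exact AddSubgroup.zsmul_mem _ (AddSubgroup.mem_zmultiples u₀) x
  -- compare the two expressions of `f u₂`
  have hfu₂ : f u₂ = (x * a) • u₀ + (y * b) • u₁ := by
    rw [hxy, map_add, map_zsmul, map_zsmul, ← ha, ← hb, mul_zsmul, mul_zsmul]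
  have hkey : (x * a - c * x) • u₀ = (c * y - y * b) • u₁ := by
    have h1 : (x * a) • u₀ + (y * b) • u₁ = (c * x) • u₀ + (c * y) • u₁ := by
      rw [← hfu₂, ← hc, hxy, zsmul_add, mul_zsmul, mul_zsmul]
    calc (x * a - c * x) • u₀ = (x * a) • u₀ - (c * x) • u₀ := sub_zsmul' _ _ _
      _ = ((x * a) • u₀ + (y * b) • u₁) - (y * b) • u₁ - (c * x) • u₀ := by rw [add_sub_cancel_right]
      _ = ((c * x) • u₀ + (c * y) • u₁) - (y * b) • u₁ - (c * x) • u₀ := by rw [h1]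
      _ = (c * y) • u₁ - (y * b) • u₁ := by abel
      _ = (c * y - y * b) • u₁ := (sub_zsmul' _ _ _).symm
  have hmem₀ : (x * a - c * x) • u₀ ∈ AddSubgroup.zmultiples u₀ ⊓ AddSubgroup.zmultiples u₁ := by
    refine AddSubgroup.mem_inf.mpr ⟨AddSubgroup.zsmul_mem _ (AddSubgroup.mem_zmultiples u₀) _, ?_⟩
    rw [hkey]
    exact AddSubgroup.zsmul_mem _ (AddSubgroup.mem_zmultiples u₁) _
  rw [zmultiples_inf_zmultiples_eq_bot hpV h₁₀, AddSubgroup.mem_bot] at hmem₀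
  have hzero₁ : (c * y - y * b) • u₁ = 0 := by rw [← hkey, hmem₀]
  -- so `p ∣ a - c` and `p ∣ b - c`
  have hdvd₀ : (p : ℤ) ∣ a - c := by
    refine natCast_dvd_of_zsmul_eq_zero hpV hx ?_
    rw [← mul_zsmul, show (a - c) * x = x * a - c * x by ring, hmem₀]
  have hdvd₁ : (p : ℤ) ∣ b - c := by
    refine natCast_dvd_of_zsmul_eq_zero hpV hy ?_
    rw [← mul_zsmul, show (b - c) * y = -(c * y - y * b) by ring, neg_zsmul, hzero₁, neg_zero]
  -- conclude on `v = a' • u₀ + b' • u₁`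
  obtain ⟨a', b', rfl⟩ := exists_eq_zsmul_add_zsmul hpV hcard hu₀ h₁₀ v
  have e₀ : a' • (a • u₀) = c • (a' • u₀) := by
    rw [← mul_zsmul, ← mul_zsmul, ← sub_eq_zero, ← sub_zsmul', show a' * a - c * a' = a' * (a - c) by ring]
    exact zsmul_eq_zero_of_natCast_dvd hpV (dvd_mul_of_dvd_right hdvd₀ a') u₀
  have e₁ : b' • (b • u₁) = c • (b' • u₁) := by
    rw [← mul_zsmul, ← mul_zsmul, ← sub_eq_zero, ← sub_zsmul', show b' * b - c * b' = b' * (b - c) by ring]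
    exact zsmul_eq_zero_of_natCast_dvd hpV (dvd_mul_of_dvd_right hdvd₁ b') u₁
  rw [map_add, map_zsmul, map_zsmul, ← ha, ← hb, e₀, e₁, zsmul_add]

end Lines

/-! ## §2 A normal subgroup with cyclic quotient generated by `γ₀`, `γ₀^{pⁿ}` inside, `p` odd -/

section Abstract

variable {Γ : Type*} [Group Γ] {V : Type*} [AddCommGroup V] [DistribMulAction Γ V] {p : ℕ} [Fact p.Prime]

/-- `g • (k • w) = k • (g • w)` for a distributive action and an integer `k`. [folklore] -/
private theorem smul_zsmul_comm (g : Γ) (k : ℤ) (w : V) : g • (k • w) = k • (g • w) :=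
  map_zsmul (DistribSMul.toAddMonoidHom V g) k w

/-- If a subgroup `U` is `g`-stable then it is `g^k`-stable. [folklore] -/
private theorem pow_smul_mem_of_forall_smul_mem {g : Γ} {U : AddSubgroup V} (hU : ∀ v ∈ U, g • v ∈ U) (k : ℕ) :
    ∀ v ∈ U, g ^ k • v ∈ U := by
  induction k with
  | zero => intro v hv; rwa [pow_zero, one_smul]
  | succ k ih => intro v hv; rw [pow_succ, mul_smul]; exact ih _ (hU v hv)

/-- A FINITE `g`-stable subgroup is `g⁻¹`-stable (`u ↦ g • u` is injective on `U`, hence onto `U`). [folklore] -/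
private theorem inv_smul_mem_of_forall_smul_mem {g : Γ} {U : AddSubgroup V} [Finite U] (hU : ∀ v ∈ U, g • v ∈ U) :
    ∀ v ∈ U, g⁻¹ • v ∈ U := by
  let φ : U → U := fun u => ⟨g • (u : V), hU u u.2⟩
  have hφ : Function.Injective φ := by
    intro u u' h
    have h' : g • (u : V) = g • (u' : V) := congrArg Subtype.val h
    exact Subtype.ext (smul_left_cancel g h')
  intro v hv
  obtain ⟨u, hu⟩ := (Finite.surjective_of_injective hφ) ⟨v, hv⟩
  have huv : g • (u : V) = v := congrArg Subtype.val hu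
  rw [← huv, inv_smul_smul]
  exact u.2

/-- The line through a common eigenvector of `Λ` which is also an eigenvector of `γ₀` is `Γ`-stable when
`Γ = ⋃_k Λ γ₀^k`; under irreducibility of `V` (order `p²`) this is impossible for a non-zero vector. [folklore] -/
private theorem false_of_eigenvector [Finite V] (hpV : ∀ v : V, p • v = 0) (hcard : Nat.card V = p ^ 2)
    (Λ : Subgroup Γ) (γ₀ : Γ) (hgen : ∀ g : Γ, ∃ h ∈ Λ, ∃ k : ℕ, g = h * γ₀ ^ k)
    (hirr : ∀ U : AddSubgroup V, (∀ γ : Γ, ∀ v ∈ U, γ • v ∈ U) → U = ⊥ ∨ U = ⊤)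
    {w : V} (hw : w ≠ 0) (hΛ : ∀ γ ∈ Λ, γ • w ∈ AddSubgroup.zmultiples w)
    (hγ₀ : γ₀ • w ∈ AddSubgroup.zmultiples w) : False := by
  have hp : p.Prime := Fact.out
  set L := AddSubgroup.zmultiples w with hL
  have hstab : ∀ g : Γ, g • w ∈ L → ∀ v ∈ L, g • v ∈ L := by
    intro g hg v hv
    obtain ⟨k, rfl⟩ := AddSubgroup.mem_zmultiples_iff.mp hv
    rw [smul_zsmul_comm]
    exact AddSubgroup.zsmul_mem _ hg k
  have hΓ : ∀ γ : Γ, ∀ v ∈ L, γ • v ∈ L := by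
    intro g v hv
    obtain ⟨h, hh, k, rfl⟩ := hgen g
    rw [mul_smul]
    exact hstab h (hΛ h hh) _ (pow_smul_mem_of_forall_smul_mem (hstab γ₀ hγ₀) k v hv)
  rcases hirr L hΓ with h | h
  · exact hw ((AddSubgroup.eq_bot_iff_forall _).mp h w (AddSubgroup.mem_zmultiples w))
  · have h1 : Nat.card L = p := natCard_zmultiples_eq hpV hw
    rw [h, AddSubgroup.card_top, hcard] at h1
    have h2 : p < p ^ 2 := by
      calc p = p ^ 1 := (pow_one p).symm
        _ < p ^ 2 := Nat.pow_lt_pow_right hp.one_lt (by norm_num)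
    exact h2.ne' h1

/-- **Irreducibility descends to a normal subgroup with cyclic quotient of `p`-power exponent, `p` odd,
on an elementary abelian group of order `p²`.**  `Γ` acts on `V` (`pV = 0`, `#V = p²`), `Λ ≤ Γ` is normal,
`Γ = ⋃_k Λ γ₀^k` and `γ₀^{pⁿ} ∈ Λ`.  If the only `Γ`-stable subgroups of `V` are `⊥`, `⊤`, then the same holds
for `Λ`.  (Clifford's theorem in its smallest case; see the file docstring for the four steps.)
[cite: Serre1972, §2.4–§2.6 (subgroups of GL₂(𝔽_p) and their normalisers)] [cite: Washington1997, §13.1] -/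
theorem irreducible_of_normal_of_generator [Finite V] (hp2 : p ≠ 2) (hpV : ∀ v : V, p • v = 0)
    (hcard : Nat.card V = p ^ 2) (Λ : Subgroup Γ) [Λ.Normal] (γ₀ : Γ) (n : ℕ) (hγ₀n : γ₀ ^ p ^ n ∈ Λ)
    (hgen : ∀ g : Γ, ∃ h ∈ Λ, ∃ k : ℕ, g = h * γ₀ ^ k)
    (hirr : ∀ U : AddSubgroup V, (∀ γ : Γ, ∀ v ∈ U, γ • v ∈ U) → U = ⊥ ∨ U = ⊤)
    (U : AddSubgroup V) (hU : ∀ γ ∈ Λ, ∀ v ∈ U, γ • v ∈ U) : U = ⊥ ∨ U = ⊤ := by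
  have hp : p.Prime := Fact.out
  rcases eq_or_ne U ⊤ with htop | htop
  · exact Or.inr htop
  rcases AddSubgroup.bot_or_exists_ne_zero U with hbot | ⟨u, huU, hu0⟩
  · exact Or.inl hbot
  have hbot : U ≠ ⊥ := fun h => hu0 ((AddSubgroup.eq_bot_iff_forall _).mp h u huU)
  exfalso
  -- Step 0: `U = ⟨u⟩` with `u ≠ 0`, and `Λ` maps `u` into `⟨u⟩`
  have hcardU : Nat.card U = p := by
    have hdvd : Nat.card U ∣ p ^ 2 := hcard ▸ AddSubgroup.card_addSubgroup_dvd_card U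
    obtain ⟨k, hk2, hk⟩ := (Nat.dvd_prime_pow hp).mp hdvd
    interval_cases k
    · exact absurd (AddSubgroup.eq_bot_of_card_eq U (by rw [hk, pow_zero])) hbot
    · rw [hk, pow_one]
    · exact absurd (AddSubgroup.eq_top_of_card_eq U (by rw [hk, hcard])) htop
  have hUeq : AddSubgroup.zmultiples u = U :=
    AddSubgroup.eq_of_le_of_card_ge (AddSubgroup.zmultiples_le.mpr huU)
      (by rw [hcardU, natCard_zmultiples_eq hpV hu0])
  have eig : ∀ γ ∈ Λ, γ • u ∈ AddSubgroup.zmultiples u := by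
    intro γ hγ
    rw [hUeq]
    exact hU γ hγ u huU
  -- conjugation: `γ₀^i • w` is again a common eigenvector of `Λ`
  have eig_smul : ∀ (g : Γ) (w : V), (∀ γ ∈ Λ, γ • w ∈ AddSubgroup.zmultiples w) →
      ∀ γ ∈ Λ, γ • (g • w) ∈ AddSubgroup.zmultiples (g • w) := by
    intro g w hw γ hγ
    have hconj : g⁻¹ * γ * g⁻¹⁻¹ ∈ Λ := Subgroup.Normal.conj_mem inferInstance γ hγ g⁻¹
    rw [inv_inv] at hconj
    obtain ⟨k, hk⟩ := AddSubgroup.mem_zmultiples_iff.mp (hw _ hconj)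
    have : γ • g • w = g • ((g⁻¹ * γ * g) • w) := by
      rw [← mul_smul, ← mul_smul, ← mul_assoc, ← mul_assoc, mul_inv_cancel, one_mul]
    rw [this, ← hk, smul_zsmul_comm]
    exact AddSubgroup.zsmul_mem _ (AddSubgroup.mem_zmultiples _) k
  -- Step 1: `γ₀ • u ∉ ⟨u⟩`
  have step1 : γ₀ • u ∉ AddSubgroup.zmultiples u :=
    fun h => false_of_eigenvector hpV hcard Λ γ₀ hgen hirr hu0 eig h
  -- Step 2: `γ₀² • u ∉ ⟨u⟩` (`p` odd)
  have hfinL : Finite (AddSubgroup.zmultiples u) :=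
    Nat.finite_of_card_ne_zero (by rw [natCard_zmultiples_eq hpV hu0]; exact hp.ne_zero)
  have hstabL : ∀ g : Γ, g • u ∈ AddSubgroup.zmultiples u → ∀ v ∈ AddSubgroup.zmultiples u,
      g • v ∈ AddSubgroup.zmultiples u := by
    intro g hg v hv
    obtain ⟨k, rfl⟩ := AddSubgroup.mem_zmultiples_iff.mp hv
    rw [smul_zsmul_comm]
    exact AddSubgroup.zsmul_mem _ hg k
  have step2 : (γ₀ ^ 2) • u ∉ AddSubgroup.zmultiples u := by
    intro h2
    apply step1
    obtain ⟨q, hq⟩ : ∃ q, p ^ n = 2 * q + 1 := (hp.odd_of_ne_two hp2).pow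
    have hinv := inv_smul_mem_of_forall_smul_mem (hstabL (γ₀ ^ 2) h2)
    have hinvq := pow_smul_mem_of_forall_smul_mem hinv q
    have hpn : γ₀ ^ p ^ n • u ∈ AddSubgroup.zmultiples u := eig _ hγ₀n
    have hγ : γ₀ = γ₀ ^ p ^ n * ((γ₀ ^ 2)⁻¹) ^ q := by
      rw [hq, inv_pow, ← pow_mul, pow_succ', mul_assoc, mul_inv_cancel, mul_one]
    rw [hγ, mul_smul]
    exact hstabL _ hpn _ (hinvq u (AddSubgroup.mem_zmultiples u))
  -- Step 3: `γ₀² • u ∉ ⟨γ₀ • u⟩`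
  have step3 : (γ₀ ^ 2) • u ∉ AddSubgroup.zmultiples (γ₀ • u) := by
    intro h3
    apply step1
    obtain ⟨k, hk⟩ := AddSubgroup.mem_zmultiples_iff.mp h3
    rw [pow_two, mul_smul, ← smul_zsmul_comm] at hk
    rw [← smul_left_cancel γ₀ hk]
    exact AddSubgroup.zsmul_mem _ (AddSubgroup.mem_zmultiples u) k
  -- Step 4: every `λ ∈ Λ` acts as an integer scalar
  have scalar : ∀ γ ∈ Λ, ∃ c : ℤ, ∀ v : V, γ • v = c • v := by
    intro γ hγ
    have h := exists_forall_eq_zsmul_of_three_eigenlines hpV hcard (DistribSMul.toAddMonoidHom V γ) hu0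
      step1 step2 step3 (eig γ hγ) (eig_smul γ₀ u eig γ hγ)
      (by have := eig_smul (γ₀ ^ 2) u eig γ hγ; exact this)
    exact h
  -- Step 5: an eigenvector of `γ₀`
  obtain ⟨c₀, hc₀⟩ := scalar _ hγ₀n
  set T : AddMonoid.End V := DistribMulAction.toAddMonoidEnd Γ V γ₀ with hT
  have hTapp : ∀ v : V, T v = γ₀ • v := fun _ => rfl
  have hTpow : ∀ v : V, (T ^ p ^ n) v = c₀ • v := by
    intro v
    rw [hT, ← map_pow]
    exact hc₀ v
  have hadd : ∀ (f g : AddMonoid.End V) (v : V), (f + g) v = f v + g v := fun _ _ _ => rfl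
  have hpR : (p : AddMonoid.End V) = 0 := by
    refine DFunLike.ext _ _ fun v => ?_
    rw [AddMonoid.End.natCast_apply, hpV, AddMonoid.End.zero_apply]
  -- Fermat: `p ∣ c₀ + (-c₀)^{pⁿ}`
  have hfermat : (p : ℤ) ∣ c₀ + (-c₀) ^ p ^ n := by
    refine (ZMod.intCast_zmod_eq_zero_iff_dvd _ p).mp ?_
    push_cast
    rw [ZMod.pow_card_pow, add_neg_cancel]
  set D : AddMonoid.End V := T + ((-c₀ : ℤ) : AddMonoid.End V) with hD
  have hDapp : ∀ v : V, D v = γ₀ • v - c₀ • v := by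
    intro v
    rw [hD, hadd, hTapp, AddMonoid.End.intCast_apply, neg_zsmul, sub_eq_add_neg]
  have hDpow : D ^ p ^ n = 0 := by
    rw [hD, (Int.commute_cast T (-c₀)).add_pow_prime_pow_eq' hp n, hpR, zero_mul, add_zero]
    refine DFunLike.ext _ _ fun v => ?_
    rw [hadd, hTpow, ← Int.cast_pow, AddMonoid.End.intCast_apply, ← add_zsmul, AddMonoid.End.zero_apply]
    exact zsmul_eq_zero_of_natCast_dvd hpV hfermat v
  -- `D` is not injective
  obtain ⟨v, hv0, hDv⟩ : ∃ v : V, v ≠ 0 ∧ D v = 0 := by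
    by_contra hall
    have hinj : Function.Injective D :=
      (injective_iff_map_eq_zero D).mpr fun v hv => by_contra fun h => hall ⟨v, h, hv⟩
    have hinjpow : Function.Injective (D ^ p ^ n) := by
      rw [AddMonoid.End.coe_pow]
      exact hinj.iterate _
    apply hu0
    apply hinjpow
    rw [hDpow, map_zero, AddMonoid.End.zero_apply]
  have hγv : γ₀ • v ∈ AddSubgroup.zmultiples v := by
    rw [hDapp, sub_eq_zero] at hDv
    rw [hDv]
    exact AddSubgroup.zsmul_mem _ (AddSubgroup.mem_zmultiples v) c₀
  have hΛv : ∀ γ ∈ Λ, γ • v ∈ AddSubgroup.zmultiples v := by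
    intro γ hγ
    obtain ⟨c, hc⟩ := scalar γ hγ
    rw [hc]
    exact AddSubgroup.zsmul_mem _ (AddSubgroup.mem_zmultiples v) c
  exact false_of_eigenvector hpV hcard Λ γ₀ hgen hirr hv0 hΛv hγv

end Abstract

/-! ## §3 The layers of a `ℤ_p`-extension and `E[p]` -/

section EllipticCurve

open Field WeierstrassCurve

variable {K : Type} [Field K] {p : ℕ} [Fact p.Prime]

/-- `Γ_K = ⋃_k Gal(K̄/K_n) γ^k` for a topological generator `γ` of a `ℤ_p`-extension (`κ γ = 1`): with
`k = (κ g mod pⁿ)`, `g γ^{-k} ∈ κ⁻¹(pⁿℤ_p)`.  (Twin of the tree's `ZpExtension.exists_layerSubgroup_mul_pow`,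
re-proved here to keep the imports light.) [cite: Washington1997, §13.1] -/
theorem exists_mem_layerSubgroup_mul_pow (κ : ZpExtension K p) {γ : absoluteGaloisGroup K}
    (hγ : κ.IsTopGenerator γ) (n : ℕ) (g : absoluteGaloisGroup K) :
    ∃ h ∈ κ.layerSubgroup n, ∃ k : ℕ, g = h * γ ^ k := by
  set x : ℤ_[p] := (κ g).toAdd with hx
  have happr := PadicInt.appr_spec n x
  refine ⟨g * (γ ^ x.appr n)⁻¹, ?_, x.appr n, by rw [inv_mul_cancel_right]⟩
  rw [ZpExtension.mem_layerSubgroup, map_mul, map_inv, toAdd_mul, toAdd_inv, map_pow,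
    show κ γ = Multiplicative.ofAdd 1 from hγ, ← ofAdd_nsmul, toAdd_ofAdd, nsmul_eq_mul, mul_one,
    ← sub_eq_add_neg]
  exact Ideal.mem_span_singleton.mp happr

/-- `γ^{pⁿ} ∈ Gal(K̄/K_n)` for a topological generator `γ` (`κ(γ^{pⁿ}) = pⁿ`). [cite: Washington1997, §13.1] -/
theorem pow_mem_layerSubgroup (κ : ZpExtension K p) {γ : absoluteGaloisGroup K} (hγ : κ.IsTopGenerator γ)
    (n : ℕ) : γ ^ p ^ n ∈ κ.layerSubgroup n := by
  rw [ZpExtension.mem_layerSubgroup, map_pow, show κ γ = Multiplicative.ofAdd 1 from hγ, ← ofAdd_nsmul,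
    toAdd_ofAdd, nsmul_eq_mul, mul_one]
  exact ⟨1, by rw [mul_one, Nat.cast_pow]⟩

variable [CharZero K] (W : WeierstrassCurve K) [W.IsElliptic]

/-- `#E[p] = p²` over a field of characteristic zero (Silverman *AEC* III.6.4 (b); tree
`card_torsionPoints_eq_sq_holds`). [cite: SilvermanAEC2009, Cor. III.6.4(b)] -/
theorem natCard_geomTorsion_eq_sq : Nat.card ↥(W.geomTorsion (p : ℤ)) = p ^ 2 := by
  haveI : CharZero (AlgebraicClosure K) :=
    charZero_of_injective_algebraMap (algebraMap K (AlgebraicClosure K)).injective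
  exact card_torsionPoints_eq_sq_holds W (AlgebraicClosure K)
    (Nat.cast_ne_zero.mpr (Fact.out : p.Prime).ne_zero)

/-- **Irreducibility of `E[p]` under `Gal(K̄/K_n)` for `p` odd — no image hypothesis.**  `K` a field of
characteristic zero, `E = W/K` elliptic, `p` an odd prime, `κ` a `ℤ_p`-extension of `K`.  If the only
`Γ_K`-stable subgroups of `E[p]` are `⊥` and `⊤` (`W.HasIrreducibleModPGaloisRep p`), then for every `n` the only
`Gal(K̄/K_n)`-stable subgroups of `E[p]` are `⊥` and `⊤` (`Gal(K̄/K_n) = κ⁻¹(pⁿℤ_p)` is normal in `Γ_K` with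
quotient `ℤ/pⁿ` generated by a topological generator `γ₀`, and `γ₀^{pⁿ} ∈ Gal(K̄/K_n)`; §2).  The tame case
(`p ∤ #Gal(K(E[p])/K)`) is the tree's `FineSelmerStabilizerDescent.irreducible_layerSubgroup_of_not_dvd_card_aut_divisionField`.
[cite: Serre1972, §2.4–§2.6] [cite: Washington1997, §13.1] -/
theorem irreducible_layerSubgroup_of_odd (hp2 : p ≠ 2) (κ : ZpExtension K p)
    (hirr : W.HasIrreducibleModPGaloisRep p) (n : ℕ) (U : AddSubgroup ↥(W.geomTorsion (p : ℤ)))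
    (hU : ∀ γ ∈ κ.layerSubgroup n, ∀ v ∈ U, γ • v ∈ U) : U = ⊥ ∨ U = ⊤ := by
  have hp : p.Prime := Fact.out
  have hcard : Nat.card ↥(W.geomTorsion (p : ℤ)) = p ^ 2 := natCard_geomTorsion_eq_sq W
  haveI : Finite ↥(W.geomTorsion (p : ℤ)) :=
    Nat.finite_of_card_ne_zero (by rw [hcard]; exact pow_ne_zero 2 hp.ne_zero)
  have hpV : ∀ v : ↥(W.geomTorsion (p : ℤ)), p • v = 0 := fun v =>
    Subtype.ext (by
      rw [AddSubmonoidClass.coe_nsmul, ZeroMemClass.coe_zero]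
      exact AddSubgroup.torsionBy.nsmul_iff.mp v.2)
  obtain ⟨γ₀, hγ₀⟩ : ∃ γ : absoluteGaloisGroup K, κ.IsTopGenerator γ := κ.surjective (Multiplicative.ofAdd 1)
  exact irreducible_of_normal_of_generator hp2 hpV hcard (κ.layerSubgroup n) γ₀ n
    (pow_mem_layerSubgroup κ hγ₀ n) (exists_mem_layerSubgroup_mul_pow κ hγ₀ n) hirr U hU

end EllipticCurve

end Literature.NumberTheory.EllipticCurves.ModPIrreducibleLayer
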